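import Literature.NumberTheory.Automorphic.CMPrincipalSeriesSpherical
import Literature.NumberTheory.Automorphic.UnitaryGroupLocalFactors
import HarnessLib

/-!
# Continuity of the module `‖·‖ : (Π_{w ∣ v} L_w)^× → ℝ≥0`, of `‖·‖^{1/2}`, and of the first coordinate
# `χ_ξ,1 = η̃₁ · μ · ‖·‖^{1/2}` of Rogawski's case-(2) character `χ_ξ` (Rogawski 1990 §12.2; Bernstein–Zelevinsky 1977 1.7)

Topic `NumberTheory/Automorphic`; namespace `Literature.NumberTheory.Automorphic.UnitaryGroup`.  THEOREMS ONLY (no definition, no named fact, no instance,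
no notation, no `sorry`).  Cell `hodgecm-mathlib`, F0∕P3 topic T3 (Keys NF1 `KeysCaseTwo`), glue G1 of the typed tree (`F0/P3/T3a-TREE.md` §3,
`F0/P3/T3b-TREE.md`): the typed nodes N1 `U3PrincipalSeriesJacquetFiltration`, N3 `U3PrincipalSeriesLengthLeTwo`, N5′ `U3PrincipalSeriesSubrepSquareIntegrable`
are stated for CONTINUOUS pairs `(χ₁, χ₂)` (the smooth induction of a discontinuous character is `0`); instantiating them at `χ_ξ = (η̃₁ μ ‖·‖^{1/2}, η₂)`
(★ `cmXiTorusChar_eq_cmTorusCharPair`) needs the continuity of `χ_ξ,1 := η₁ ∘ quotConj · μ · halfModulusChar` on `(Π_{w∣v} L_w)^×`, proved here from the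
continuity of `μ`, `η₁` and of complex conjugation `c ⊗ 1` (★ `continuous_conjLocal`).  The one non-formal input is the **continuity of the module**
`unitModulusChar = distribHaarChar` on the units of the local ring: it is LOCALLY CONSTANT, being a homomorphism that is trivial on the OPEN subgroup
`Π_{w∣v} 𝒪_w^×` (★ `unitModulusChar_eq_one_of_forall_v_eq_one`).  HC_CM is proved only modulo the printed citations until rung 0 closes; this file is
unconditional.

## The print
[BernsteinZelevinsky1977] 1.7: the module `Δ` of an l-group is a (continuous, locally constant) character; [Rogawski1990] §12.2 p. 173 «`‖α‖`» on `E^*`, a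
continuous quasi-character (so `χ = (χ₁, χ₂)` with `χ₁ = η‖·‖^{1/2}` is a character of `M` in the sense of §12.1, i.e. continuous); [CartierCorvallis1979] §I.1
(characters of `F^×` are determined by their restriction to `𝒪^×` and the value at a uniformiser; unramified ⇔ trivial on `𝒪^×`).

## What is formalised (`R := LocalRing L v = Π_{w∣v} L_w`)
* `isOpen_setOf_forall_v_eq_one` — `{u ∈ R^× : v(u_w) = 1 ∀ w}` is open in `R^×` (it is `{u : u ∈ Π𝒪_w ∧ u⁻¹ ∈ Π𝒪_w}`, ★ `Units.continuous_val`,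
  `Units.continuous_coe_inv`, `Valued.isOpen_valuationSubring`);
* **`continuous_unitModulusChar`** — `‖·‖ : R^× → ℝ≥0` is continuous (locally constant: `‖u₀ u‖ = ‖u₀‖` for `u` in that open subgroup);
* `continuous_halfModulusChar_apply` — `x ↦ ‖x‖^{1/2} ∈ ℂ` is continuous;
* `continuous_quotConj` — `a ↦ a/σ(a) : R^× → E¹` is continuous for a continuous involution `σ` (generic topological ring);
* **`continuous_cmXiTorusChar_fst`** — `x ↦ (η₁(x/x̄) · μ(x) · ‖x‖^{1/2} : ℂ)` is continuous on `R^×` when `μ` and `η₁` are — the hypothesis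
  `Continuous (fun x => ((χ₁ x : ℂˣ) : ℂ))` of N1∕N3∕N5′ at `χ₁ := η₁.comp (quotConj …) * μ * halfModulusChar R` (the first coordinate of `χ_ξ`).

## References
* [BernsteinZelevinsky1977] I. N. Bernstein, A. V. Zelevinsky, *Induced representations of reductive p-adic groups I*, ASENS 10 (1977), 1.7.
* [Rogawski1990] J. D. Rogawski, *Automorphic Representations of Unitary Groups in Three Variables* (1990), §12.1 p. 171, §12.2 p. 173.
* [CartierCorvallis1979] P. Cartier, *Representations of p-adic groups: a survey*, Proc. Symp. Pure Math. 33 (1979) part 1, §I.1.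
-/

set_option autoImplicit false

noncomputable section

open NumberField IsDedekindDomain MeasureTheory Topology
open scoped NNReal Pointwise

namespace Literature.NumberTheory.Automorphic.UnitaryGroup

/-! ## §1 `a ↦ a/σ(a)` is continuous -/

section Generic

variable {R : Type*} [CommRing R] [TopologicalSpace R] [IsTopologicalRing R] (σ : R →+* R)

/-- **`a ↦ a/σ(a) = a · σ(a)⁻¹ : R^× → E¹` is continuous** for a continuous involution `σ` (★ `quotConj`; `Units.map σ` is continuous on units, ★
Mathlib `Continuous.units_map`). [cite: Rogawski1990, §12.1 p. 172] -/
theorem continuous_quotConj (hσ : ∀ x : R, σ (σ x) = x) (hσc : Continuous σ) : Continuous (quotConj σ hσ) := by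
  have hmap : Continuous (Units.map (σ : R →* R)) := Continuous.units_map _ hσc
  refine Continuous.subtype_mk ?_ _
  exact continuous_id.mul hmap.inv

end Generic

/-! ## §2 The module on `(Π_{w ∣ v} L_w)^×` is locally constant, hence continuous -/

section CM

variable (L : Type) [Field L] [NumberField L] (v : HeightOneSpectrum (𝓞 ↥(maximalRealSubfield L)))

/-- **The integral units `{u : v(u_w) = 1 for all w ∣ v}` form an OPEN subset of `(Π_{w∣v} L_w)^×`**: `u` lies in it iff both `u` and `u⁻¹` lie in the open box
`Π_w 𝒪_w` (a unit of valuation `≤ 1` whose inverse also has valuation `≤ 1` has valuation `1`). [cite: CartierCorvallis1979, §I.1] -/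
theorem isOpen_setOf_forall_v_eq_one :
    IsOpen {u : (LocalRing L v)ˣ | ∀ w : PlacesOver L v, Valued.v ((u : LocalRing L v) w) = 1} := by
  set s : Set (LocalRing L v) :=
    Set.pi Set.univ fun w : PlacesOver L v => (w.1.adicCompletionIntegers L : Set (w.1.adicCompletion L)) with hs
  have hso : IsOpen s := isOpen_set_pi Set.finite_univ fun w _ => Valued.isOpen_valuationSubring _
  have heq : {u : (LocalRing L v)ˣ | ∀ w : PlacesOver L v, Valued.v ((u : LocalRing L v) w) = 1} =
      (fun u : (LocalRing L v)ˣ => (u : LocalRing L v)) ⁻¹' s ∩ (fun u : (LocalRing L v)ˣ => ((u⁻¹ : (LocalRing L v)ˣ) : LocalRing L v)) ⁻¹' s := by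
    ext u
    simp only [Set.mem_setOf_eq, Set.mem_inter_iff, Set.mem_preimage, hs, Set.mem_univ_pi]
    constructor
    · intro hu
      have hu' : ∀ w, Valued.v (((u⁻¹ : (LocalRing L v)ˣ) : LocalRing L v) w) = 1 := fun w => by
        have hprod : Valued.v (((u⁻¹ : (LocalRing L v)ˣ) : LocalRing L v) w) * Valued.v ((u : LocalRing L v) w) = 1 := by
          rw [← map_mul, ← Pi.mul_apply, Units.inv_mul, Pi.one_apply, map_one]
        rwa [hu w, mul_one] at hprod
      exact ⟨fun w => show Valued.v ((u : LocalRing L v) w) ≤ 1 from (hu w).le,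
        fun w => show Valued.v (((u⁻¹ : (LocalRing L v)ˣ) : LocalRing L v) w) ≤ 1 from (hu' w).le⟩
    · rintro ⟨h1, h2⟩ w
      have h1w : Valued.v ((u : LocalRing L v) w) ≤ 1 := h1 w
      have h2w : Valued.v (((u⁻¹ : (LocalRing L v)ˣ) : LocalRing L v) w) ≤ 1 := h2 w
      have hprod : Valued.v (((u⁻¹ : (LocalRing L v)ˣ) : LocalRing L v) w) * Valued.v ((u : LocalRing L v) w) = 1 := by
        rw [← map_mul, ← Pi.mul_apply, Units.inv_mul, Pi.one_apply, map_one]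
      exact le_antisymm h1w (hprod.symm.trans_le ((mul_le_mul_left h2w _).trans_eq (one_mul _)))
  rw [heq]
  exact (hso.preimage Units.continuous_val).inter (hso.preimage Units.continuous_coe_inv)

/-- **The module `‖·‖ : (Π_{w∣v} L_w)^× → ℝ≥0` (★ `unitModulusChar` = Mathlib `distribHaarChar`) is continuous** — indeed locally constant: near `u₀` every unit is
`u₀ · u` with `v(u_w) = 1` for all `w`, and `‖u₀ u‖ = ‖u₀‖ · ‖u‖ = ‖u₀‖` (★ `unitModulusChar_eq_one_of_forall_v_eq_one`).
[cite: BernsteinZelevinsky1977, 1.7] [cite: Rogawski1990, §12.2 p. 173] -/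
theorem continuous_unitModulusChar : Continuous (unitModulusChar (LocalRing L v)) := by
  set U : Set (LocalRing L v)ˣ := {u | ∀ w : PlacesOver L v, Valued.v ((u : LocalRing L v) w) = 1} with hU
  have hUo : IsOpen U := isOpen_setOf_forall_v_eq_one L v
  refine continuous_iff_continuousAt.2 fun u₀ => ?_
  -- on the neighbourhood `u₀ • U` of `u₀` the module is constant
  have hnhds : u₀ • U ∈ 𝓝 u₀ := by
    refine (hUo.smul u₀).mem_nhds ?_
    exact ⟨1, fun w => by rw [Units.val_one, Pi.one_apply, map_one], by simp [smul_eq_mul]⟩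
  refine (continuousAt_const (y := unitModulusChar (LocalRing L v) u₀)).congr ?_
  filter_upwards [hnhds] with u hu
  obtain ⟨u', hu', rfl⟩ := hu
  show unitModulusChar (LocalRing L v) u₀ = unitModulusChar (LocalRing L v) (u₀ • u')
  rw [smul_eq_mul, map_mul, unitModulusChar_eq_one_of_forall_v_eq_one L v u' hu', mul_one]

/-- **`x ↦ ‖x‖^{1/2} ∈ ℂ` is continuous on `(Π_{w∣v} L_w)^×`** (★ `halfModulusChar`, through `ℝ≥0 → ℝ → ℂ`). [cite: Rogawski1990, §12.2 p. 173] -/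
theorem continuous_halfModulusChar_apply :
    Continuous fun x : (LocalRing L v)ˣ => ((halfModulusChar (LocalRing L v) x : ℂˣ) : ℂ) := by
  have h : (fun x : (LocalRing L v)ˣ => ((halfModulusChar (LocalRing L v) x : ℂˣ) : ℂ)) =
      fun x => (((NNReal.sqrt (unitModulusChar (LocalRing L v) x) : ℝ≥0) : ℝ) : ℂ) := by
    funext x; exact coe_halfModulusChar_apply (LocalRing L v) x
  rw [h]
  exact Complex.continuous_ofReal.comp
    (NNReal.continuous_coe.comp (NNReal.continuous_sqrt.comp (continuous_unitModulusChar L v)))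

variable [IsCMField L]

/-- **The first coordinate `χ_ξ,1 = η̃₁ · μ · ‖·‖^{1/2}` of `χ_ξ` is continuous** on `(Π_{w∣v} L_w)^×` when `μ` and `η₁` are (with `η̃₁(x) = η₁(x/x̄)`, ★ `quotConj`
along the continuous involution `c ⊗ 1` = ★ `conjLocal`, ★ `continuous_conjLocal`) — the hypothesis «`Continuous (fun x => ((χ₁ x : ℂˣ) : ℂ))`» of the typed nodes
`U3PrincipalSeriesJacquetFiltration` ∕ `U3PrincipalSeriesLengthLeTwo` ∕ `U3PrincipalSeriesSubrepSquareIntegrable` at `χ₁ := η₁ ∘ quotConj · μ · ‖·‖^{1/2}`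
(★ `cmXiTorusChar_eq_cmTorusCharPair`: `χ_ξ = cmTorusCharPair L v χ₁ η₂`). [cite: Rogawski1990, §12.1 p. 171; §12.2 (2) p. 174] -/
theorem continuous_cmXiTorusChar_fst (μ : (LocalRing L v)ˣ →* ℂˣ)
    (η₁ : ↥(normOneUnits (conjLocal L (IsCMField.complexConj L) v)) →* ℂˣ)
    (hμc : Continuous fun x => ((μ x : ℂˣ) : ℂ)) (h1c : Continuous fun x => ((η₁ x : ℂˣ) : ℂ)) :
    Continuous fun x : (LocalRing L v)ˣ =>
      (((η₁.comp (quotConj (conjLocal L (IsCMField.complexConj L) v) (conjLocal_conjLocal_cm L v)) * μ *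
          halfModulusChar (LocalRing L v)) x : ℂˣ) : ℂ) := by
  have hq : Continuous (quotConj (conjLocal L (IsCMField.complexConj L) v) (conjLocal_conjLocal_cm L v)) :=
    continuous_quotConj _ (conjLocal_conjLocal_cm L v) (continuous_conjLocal L (IsCMField.complexConj L) v)
  have h1 : Continuous fun x : (LocalRing L v)ˣ =>
      ((η₁ (quotConj (conjLocal L (IsCMField.complexConj L) v) (conjLocal_conjLocal_cm L v) x) : ℂˣ) : ℂ) := h1c.comp hq
  simp only [MonoidHom.mul_apply, MonoidHom.comp_apply, Units.val_mul]
  exact (h1.mul hμc).mul (continuous_halfModulusChar_apply L v)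

end CM

end Literature.NumberTheory.Automorphic.UnitaryGroup

end
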